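import Summits.BirchSwinnertonDyer.BirchSwinnertonDyer.Theorems.BiquadraticEisensteinDescentHeegnerTwistCouplingInSupplySymbolicMonskyEvenKernelParity
import Summits.BirchSwinnertonDyer.BirchSwinnertonDyer.Theorems.BiquadraticEisensteinDescentHeegnerTwistCouplingInSupplySymbolicMonskyMuOneLaplacian
import HarnessLib

set_option linter.dupNamespace false -- `Summit.BirchSwinnertonDyer.BirchSwinnertonDyer.Theorems.…` (summit = sub)
set_option autoImplicit false

/-!
# Crux `HeegnerTwistCouplingInSupply` (stmt-BirchSwinnertonDyer-21381) — EVEN bases with exactly one prime `≡ 3 (mod 4)` (μ = 1):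
# at the design `δ = 1` the `0 × V` section of the even pencil is never larger than the `V × 0` section, so it never obstructs

Route `BiquadraticEisensteinDescent` (cell `pub/bsd-wall`, width seat `bsd-wall-cm-bed-w3` g24; `--supports` 21381, helper). Setting of
`…SymbolicMonskyEvenKernelParity` (p751399): EVEN THEOREM A (`exists_patternFree_even_design_pencil_of_odd`) produces a pattern-free Heegner
recipe from a `(2/·)`-vector `δ` whose even pencil `W_ev(δ)` meets `V × 0`, `0 × V` and the diagonal in dimension `≤ τ₀ = (dim 𝒦_ev + 1)/2`.
Memo EVEN-EXCEPTIONAL-CLASS-w3g24 §2b conjectures (★): at `δ = 1` the `0 × V` condition ALWAYS holds (no «a₂-exceptional class»; > 10⁶ bases,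
0 failures). This file proves (★) for every even base with μ = 1 (one base prime `≡ 3 (mod 4)`, at index `b₀`; any classes mod 8 otherwise):
* ★★ `finrank_evenPencil_one_inf_ker_fst_le` — `dim (W_ev(1) ∩ 0×V) ≤ dim (W_ev(1) ∩ V×0)`. Mechanism: with `Φ := L + D_d + d·e_{b₀}ᵀ`
  (`(Φw)_i = (Lw)_i + d_i w_i + d_i w_{b₀}`), `ker Φ × 0 ⊆ W_ev(1) ∩ V×0` while `W_ev(1) ∩ 0×V ⊆ 0 × ker Φᵀ` (the second inclusion is the
  orthogonality `⟨Φ w, u⟩ = 0` of the alternating form `Ŝ + ccᵀ` between its radical and the isotropic plane `u = 0`, written out with the μ = 1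
  symmetry of the Laplacian `lap_adjoint`), and `dim ker Φ = dim ker Φᵀ`;
* ★★ `two_mul_finrank_evenPencil_one_inf_ker_fst_le` — hence `2·dim (W_ev(1) ∩ 0×V) ≤ dim 𝒦_ev + 1 = 2τ₀` (the two sections are disjoint
  inside `W_ev(1)`, which has dimension `dim 𝒦_ev + 1` by `finrank_evenPencil_eq`): condition (h2) of EVEN THEOREM A holds at `δ = 1` for every
  μ = 1 base — the conjectured inequality (★) in this family;
* ★★★ `exists_patternFree_even_design_one_of_muOne` — so for a μ = 1 even base a pattern-free Heegner recipe with `τ₀ + 1` auxiliary primes exists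
  as soon as `W_ev(1)` meets `V × 0` and the diagonal in dimension `≤ τ₀` (two conditions instead of three; both can fail: the K = 5 base of
  `even_universality_fails`, p750799, has μ = 1).
HONEST FRAMING: RUNG-LEVEL corner layer (even congruent `j = 1728` families `E_{2n₀}`); `𝔽₂`-linear algebra attached to Monsky matrices
[cite: HeathBrown1994SelmerCongruentII, Appendix (Monsky), typescript p. 41 L20–L36]; the crux as stated (C⁺), its registered stubs and BSD are
NOT touched; nothing is closed. THEOREMS ONLY (no `def`, no instance, no notation).
-/

namespace Summit.BirchSwinnertonDyer.BirchSwinnertonDyer.Theorems.SymbolicMonsky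

section MuOneEven

open Module Matrix

variable {k : ℕ} (base : SymbData (k + 1))

/-- Row of the μ = 1 coupling matrix `Φ = L + D_d + d·e_{b₀}ᵀ`: `(Φ w)_i = Σ_j [(P_j/P_i) = −1](w_j + w_i) + d_i w_i + d_i w_{b₀}`. -/
private theorem phi_mulVec (b₀ : Fin (k + 1)) (w : Fin (k + 1) → ZMod 2) (i : Fin (k + 1)) :
    ((Matrix.of fun i j : Fin (k + 1) => bz (base.neg i j) +
        (if i = j then (∑ l, bz (base.neg i l)) + bz (negTwo (base.cls i)) else 0) +
        (if j = b₀ then bz (negTwo (base.cls i)) else 0)) *ᵥ w) i =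
      (∑ j, bz (base.neg i j) * (w j + w i)) + bz (negTwo (base.cls i)) * w i + bz (negTwo (base.cls i)) * w b₀ := by
  simp only [mulVec, dotProduct, Matrix.of_apply]
  have e1 : (∑ j, (bz (base.neg i j) + (if i = j then (∑ l, bz (base.neg i l)) + bz (negTwo (base.cls i)) else 0) +
        (if j = b₀ then bz (negTwo (base.cls i)) else 0)) * w j) =
      (∑ j, bz (base.neg i j) * w j) + (∑ j, (if i = j then ((∑ l, bz (base.neg i l)) + bz (negTwo (base.cls i))) * w j else 0)) +
        ∑ j, (if j = b₀ then bz (negTwo (base.cls i)) * w j else 0) := by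
    rw [← Finset.sum_add_distrib, ← Finset.sum_add_distrib]
    refine Finset.sum_congr rfl fun j _ => ?_
    split_ifs <;> ring
  have e2 : (∑ j, bz (base.neg i j) * (w j + w i)) = (∑ j, bz (base.neg i j) * w j) + (∑ l, bz (base.neg i l)) * w i := by
    rw [Finset.sum_mul, ← Finset.sum_add_distrib]
    exact Finset.sum_congr rfl fun j _ => by ring
  rw [e1, Finset.sum_ite_eq, Finset.sum_ite_eq', e2]
  simp only [Finset.mem_univ, if_true]
  ring

/-- Row of the transpose `Φᵀ` for a μ = 1 base (the symbol matrix is then symmetric, `bz_neg_add_bz_neg_swap`):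
`(Φᵀ u)_j = Σ_i [(P_i/P_j) = −1](u_i + u_j) + d_j u_j + [j = b₀]·Σ_i d_i u_i`. -/
private theorem phiT_mulVec (b₀ : Fin (k + 1)) (hμ : ∀ b, negNegOne (base.cls b) = true ↔ b = b₀)
    (u : Fin (k + 1) → ZMod 2) (j : Fin (k + 1)) :
    ((Matrix.of fun i j : Fin (k + 1) => bz (base.neg i j) +
        (if i = j then (∑ l, bz (base.neg i l)) + bz (negTwo (base.cls i)) else 0) +
        (if j = b₀ then bz (negTwo (base.cls i)) else 0))ᵀ *ᵥ u) j =
      (∑ i, bz (base.neg j i) * (u i + u j)) + bz (negTwo (base.cls j)) * u j +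
        (if j = b₀ then ∑ i, bz (negTwo (base.cls i)) * u i else 0) := by
  simp only [mulVec, dotProduct, transpose_apply, Matrix.of_apply]
  have hs : ∀ i, bz (base.neg i j) = bz (base.neg j i) := fun i => by
    have h := bz_neg_add_bz_neg_swap base b₀ hμ i j
    have h2 : bz (base.neg j i) + bz (base.neg j i) = 0 := zmod_two_add_self _
    linear_combination h - h2
  have e1 : (∑ i, (bz (base.neg i j) + (if i = j then (∑ l, bz (base.neg i l)) + bz (negTwo (base.cls i)) else 0) +
        (if j = b₀ then bz (negTwo (base.cls i)) else 0)) * u i) =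
      (∑ i, bz (base.neg j i) * u i) + (∑ i, (if i = j then ((∑ l, bz (base.neg i l)) + bz (negTwo (base.cls i))) * u i else 0)) +
        ∑ i, (if j = b₀ then bz (negTwo (base.cls i)) * u i else 0) := by
    rw [← Finset.sum_add_distrib, ← Finset.sum_add_distrib]
    refine Finset.sum_congr rfl fun i _ => ?_
    rw [hs i]
    split_ifs <;> ring
  have e2 : (∑ i, bz (base.neg j i) * (u i + u j)) = (∑ i, bz (base.neg j i) * u i) + (∑ l, bz (base.neg j l)) * u j := by
    rw [Finset.sum_mul, ← Finset.sum_add_distrib]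
    exact Finset.sum_congr rfl fun i _ => by ring
  have e3 : (∑ i, (if j = b₀ then bz (negTwo (base.cls i)) * u i else 0)) =
      if j = b₀ then ∑ i, bz (negTwo (base.cls i)) * u i else 0 := by
    split_ifs <;> simp
  rw [e1, Finset.sum_ite_eq', e2, e3]
  simp only [Finset.mem_univ, if_true]
  ring

/-- `δ = 1` is always a legitimate design when some base prime is `≡ 3 (mod 4)`: `(1, 1+1) ∉ T_1(𝒦_ev)` (else `(0, 1) ∈ 𝒦_ev`, whose first
equation at `b₀` reads `1 = 0`). -/
theorem evenPencil_one_legit (b₀ : Fin (k + 1)) (hb₀ : negNegOne (base.cls b₀) = true) :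
    (((fun _ => (1 : ZMod 2)), fun _ => 1 + (1 : ZMod 2)) : (Fin (k + 1) → ZMod 2) × (Fin (k + 1) → ZMod 2)) ∉
      base.evenVirtualKernel.map (base.evenTwist fun _ => 1) := by
  have h11 : (1 : ZMod 2) + 1 = 0 := zmod_two_add_self 1
  intro h
  obtain ⟨q, hq, hTq⟩ := Submodule.mem_map.1 h
  rw [evenTwist_apply] at hTq
  have hq1 : ∀ i, q.1 i = 0 := fun i => by
    have := congrFun (congrArg Prod.snd hTq) i
    simp only at this
    rw [this, h11]
  have hq2 : ∀ i, q.2 i = 1 := fun i => by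
    have := congrFun (congrArg Prod.fst hTq) i
    simp only [h11, mul_zero, add_zero] at this
    exact this
  have e := ((mem_evenVirtualKernel_iff base q).1 hq).1 b₀
  simp only [hq1, hq2, add_zero, mul_zero, Finset.sum_const_zero, zero_add, mul_one, hb₀] at e
  exact one_ne_zero e

/-- ★★ **(★) for μ = 1: the `0 × V` section of `W_ev(1)` is at most the `V × 0` section.** For an even base with exactly one prime
`≡ 3 (mod 4)` (at index `b₀`), `dim (W_ev(1) ∩ 0×V) ≤ dim (W_ev(1) ∩ V×0)`. Proof: `W_ev(1) = {(v + γ·1, u) : (u,v) ∈ 𝒦_ev, γ ∈ 𝔽₂}`;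
with `Φ := L + D_d + d·e_{b₀}ᵀ` one has `ker Φ × 0 ⊆ W_ev(1) ∩ V×0` (take `u = 0`, `γ = w_{b₀}`) and `W_ev(1) ∩ 0×V ⊆ 0 × ker Φᵀ` (the even
kernel equations of `(u, γ·1)` and their sum `u_{b₀} + ⟨d,u⟩ + γ = 0`), and `dim ker Φᵀ = dim ker Φ` (row rank = column rank).
[cite: HeathBrown1994SelmerCongruentII, Appendix (Monsky), typescript p. 41 L20–L36] -/
theorem finrank_evenPencil_one_inf_ker_fst_le (b₀ : Fin (k + 1)) (hμ : ∀ b, negNegOne (base.cls b) = true ↔ b = b₀) :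
    finrank (ZMod 2) ↥(base.evenPencil (fun _ => 1) ⊓
        LinearMap.ker (LinearMap.fst (ZMod 2) (Fin (k + 1) → ZMod 2) (Fin (k + 1) → ZMod 2))) ≤
      finrank (ZMod 2) ↥(base.evenPencil (fun _ => 1) ⊓
        LinearMap.ker (LinearMap.snd (ZMod 2) (Fin (k + 1) → ZMod 2) (Fin (k + 1) → ZMod 2))) := by
  have h2 : ∀ x : ZMod 2, x + x = 0 := by decide
  have h11 : (1 : ZMod 2) + 1 = 0 := h2 1
  have hm := bz_negNegOne_eq base b₀ hμ
  -- `⟨m, x⟩ = x_{b₀}` and `Σ_b m_b = 1`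
  have hmx : ∀ x : Fin (k + 1) → ZMod 2, (∑ j, bz (negNegOne (base.cls j)) * x j) = x b₀ := by
    intro x
    rw [Finset.sum_congr rfl fun j (_ : j ∈ Finset.univ) => by rw [hm j]]
    simp
  set Φ : Matrix (Fin (k + 1)) (Fin (k + 1)) (ZMod 2) := Matrix.of fun i j : Fin (k + 1) => bz (base.neg i j) +
      (if i = j then (∑ l, bz (base.neg i l)) + bz (negTwo (base.cls i)) else 0) +
      (if j = b₀ then bz (negTwo (base.cls i)) else 0) with hΦ
  set δ : Fin (k + 1) → ZMod 2 := fun _ => 1 with hδ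
  -- elements of the pencil at `δ = 1`
  have hpen : ∀ p : (Fin (k + 1) → ZMod 2) × (Fin (k + 1) → ZMod 2), p ∈ base.evenPencil δ ↔
      ∃ (u v : Fin (k + 1) → ZMod 2) (γ : ZMod 2), (u, v) ∈ base.evenVirtualKernel ∧ p = (fun b => v b + γ, u) := by
    intro p
    rw [mem_evenPencil_iff]
    constructor
    · rintro ⟨u, v, γ, hE1, hE2, rfl⟩
      refine ⟨u, v, γ, (mem_evenVirtualKernel_iff base (u, v)).2 ⟨hE1, hE2⟩, Prod.ext ?_ ?_⟩
      · funext b; simp [hδ, h11]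
      · funext b; simp [hδ, h11]
    · rintro ⟨u, v, γ, huv, rfl⟩
      obtain ⟨hE1, hE2⟩ := (mem_evenVirtualKernel_iff base (u, v)).1 huv
      refine ⟨u, v, γ, hE1, hE2, Prod.ext ?_ ?_⟩
      · funext b; simp [hδ, h11]
      · funext b; simp [hδ, h11]
  -- (1) the `0 × V` section lies in `0 × ker Φᵀ`
  have hCle : base.evenPencil δ ⊓ LinearMap.ker (LinearMap.fst (ZMod 2) (Fin (k + 1) → ZMod 2) (Fin (k + 1) → ZMod 2)) ≤
      (LinearMap.ker Φᵀ.mulVecLin).map (LinearMap.inr (ZMod 2) (Fin (k + 1) → ZMod 2) (Fin (k + 1) → ZMod 2)) := by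
    intro p hp
    obtain ⟨hpW, hp0⟩ := Submodule.mem_inf.1 hp
    obtain ⟨u, v, γ, huv, rfl⟩ := (hpen p).1 hpW
    rw [LinearMap.mem_ker, LinearMap.fst_apply] at hp0
    have hv : ∀ b, v b = γ := fun b => by
      have := congrFun hp0 b
      simp only [Pi.zero_apply] at this
      linear_combination this - h2 γ
    obtain ⟨hE1, -⟩ := (mem_evenVirtualKernel_iff base (u, v)).1 huv
    -- the first kernel equations, with `⟨m,u⟩ = u_{b₀}` and `v = γ·1`
    have e1 : ∀ i, (∑ j, bz (base.neg i j) * (u j + u i)) + bz (negNegOne (base.cls i)) * u b₀ +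
        bz (negTwo (base.cls i)) * u i + bz (negNegOne (base.cls i)) * γ = 0 := fun i => by
      have e := hE1 i
      simp only [hmx, hv] at e
      exact e
    -- their sum: `u_{b₀} + ⟨d,u⟩ + γ = 0`
    have esum : u b₀ + (∑ i, bz (negTwo (base.cls i)) * u i) + γ = 0 := by
      have hs : (∑ i, ((∑ j, bz (base.neg i j) * (u j + u i)) + bz (negNegOne (base.cls i)) * u b₀ +
          bz (negTwo (base.cls i)) * u i + bz (negNegOne (base.cls i)) * γ)) = 0 :=
        Finset.sum_eq_zero fun i _ => e1 i
      rw [Finset.sum_add_distrib, Finset.sum_add_distrib, Finset.sum_add_distrib, sum_lap_eq_zero base b₀ hμ, zero_add,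
        hmx (fun _ => u b₀), hmx (fun _ => γ)] at hs
      exact hs
    refine Submodule.mem_map.2 ⟨u, ?_, ?_⟩
    · rw [LinearMap.mem_ker, mulVecLin_apply]
      funext j
      rw [phiT_mulVec base b₀ hμ, Pi.zero_apply]
      have ej := e1 j
      rw [hm j] at ej
      by_cases hj : j = b₀
      · rw [if_pos hj] at ej ⊢
        linear_combination ej + esum - h2 (u b₀) - h2 γ
      · rw [if_neg hj] at ej ⊢
        linear_combination ej
    · refine Prod.ext ?_ rfl
      rw [LinearMap.inr_apply]
      exact hp0.symm
  -- (2) `ker Φ × 0` lies in the `V × 0` section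
  have hAge : (LinearMap.ker Φ.mulVecLin).map (LinearMap.inl (ZMod 2) (Fin (k + 1) → ZMod 2) (Fin (k + 1) → ZMod 2)) ≤
      base.evenPencil δ ⊓ LinearMap.ker (LinearMap.snd (ZMod 2) (Fin (k + 1) → ZMod 2) (Fin (k + 1) → ZMod 2)) := by
    intro p hp
    obtain ⟨w, hw, rfl⟩ := Submodule.mem_map.1 hp
    rw [LinearMap.mem_ker, mulVecLin_apply] at hw
    have hφ : ∀ i, (∑ j, bz (base.neg i j) * (w j + w i)) + bz (negTwo (base.cls i)) * w i +
        bz (negTwo (base.cls i)) * w b₀ = 0 := fun i => by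
      have := congrFun hw i
      rwa [phi_mulVec, Pi.zero_apply] at this
    refine Submodule.mem_inf.2 ⟨?_, by rw [LinearMap.mem_ker, LinearMap.snd_apply, LinearMap.inl_apply]⟩
    rw [hpen]
    refine ⟨0, fun b => w b + w b₀, w b₀, ?_, Prod.ext ?_ rfl⟩
    · rw [mem_evenVirtualKernel_iff]
      refine ⟨fun i => ?_, fun i => ?_⟩
      · simp only [Pi.zero_apply, add_zero, mul_zero, Finset.sum_const_zero, zero_add]
        rw [hm i]
        split_ifs with hi
        · rw [hi, h2, mul_zero]
        · rw [zero_mul]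
      · simp only [Pi.zero_apply, mul_zero, Finset.sum_const_zero, zero_add, add_zero]
        rw [lap_add_const base w (w b₀) i, hm i]
        split_ifs with hi
        · rw [hi]
          linear_combination hφ b₀ + h2 (w b₀)
        · linear_combination hφ i
    · funext b
      simp only [LinearMap.inl_apply]
      linear_combination -(h2 (w b₀))
  -- (3) `dim ker Φᵀ = dim ker Φ`
  have hrank : finrank (ZMod 2) ↥(LinearMap.ker Φᵀ.mulVecLin) = finrank (ZMod 2) ↥(LinearMap.ker Φ.mulVecLin) := by
    have r1 := LinearMap.finrank_range_add_finrank_ker Φ.mulVecLin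
    have r2 := LinearMap.finrank_range_add_finrank_ker Φᵀ.mulVecLin
    have rt : Φᵀ.rank = Φ.rank := rank_transpose Φ
    change Φᵀ.rank + _ = _ at r2
    change Φ.rank + _ = _ at r1
    omega
  -- assemble
  have hinr : Function.Injective (LinearMap.inr (ZMod 2) (Fin (k + 1) → ZMod 2) (Fin (k + 1) → ZMod 2)) := LinearMap.inr_injective
  have hinl : Function.Injective (LinearMap.inl (ZMod 2) (Fin (k + 1) → ZMod 2) (Fin (k + 1) → ZMod 2)) := LinearMap.inl_injective
  calc finrank (ZMod 2) ↥(base.evenPencil δ ⊓ LinearMap.ker (LinearMap.fst (ZMod 2) (Fin (k + 1) → ZMod 2) (Fin (k + 1) → ZMod 2)))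
      ≤ finrank (ZMod 2) ↥((LinearMap.ker Φᵀ.mulVecLin).map (LinearMap.inr (ZMod 2) (Fin (k + 1) → ZMod 2) (Fin (k + 1) → ZMod 2))) :=
        Submodule.finrank_mono hCle
    _ = finrank (ZMod 2) ↥(LinearMap.ker Φᵀ.mulVecLin) := (LinearEquiv.finrank_eq (Submodule.equivMapOfInjective _ hinr _)).symm
    _ = finrank (ZMod 2) ↥(LinearMap.ker Φ.mulVecLin) := hrank
    _ = finrank (ZMod 2) ↥((LinearMap.ker Φ.mulVecLin).map (LinearMap.inl (ZMod 2) (Fin (k + 1) → ZMod 2) (Fin (k + 1) → ZMod 2))) :=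
        LinearEquiv.finrank_eq (Submodule.equivMapOfInjective _ hinl _)
    _ ≤ finrank (ZMod 2) ↥(base.evenPencil δ ⊓ LinearMap.ker (LinearMap.snd (ZMod 2) (Fin (k + 1) → ZMod 2) (Fin (k + 1) → ZMod 2))) :=
        Submodule.finrank_mono hAge

/-- ★★ **(★) for μ = 1, dimension form.** For an even base with exactly one prime `≡ 3 (mod 4)`:
`2 · dim (W_ev(1) ∩ 0×V) ≤ dim 𝒦_ev + 1` (`= 2τ₀` by the kernel parity `odd_finrank_evenVirtualKernel`). The `0 × V` and `V × 0` sections are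
disjoint subspaces of `W_ev(1)`, which has dimension `dim 𝒦_ev + 1` (`finrank_evenPencil_eq`, `evenPencil_one_legit`), and the former is the
smaller one (`finrank_evenPencil_one_inf_ker_fst_le`). So condition (h2) of EVEN THEOREM A holds at `δ = 1` for every μ = 1 base.
[cite: HeathBrown1994SelmerCongruentII, Appendix (Monsky), typescript p. 41 L20–L36] -/
theorem two_mul_finrank_evenPencil_one_inf_ker_fst_le (b₀ : Fin (k + 1)) (hμ : ∀ b, negNegOne (base.cls b) = true ↔ b = b₀) :
    2 * finrank (ZMod 2) ↥(base.evenPencil (fun _ => 1) ⊓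
        LinearMap.ker (LinearMap.fst (ZMod 2) (Fin (k + 1) → ZMod 2) (Fin (k + 1) → ZMod 2))) ≤
      finrank (ZMod 2) ↥base.evenVirtualKernel + 1 := by
  have hle := finrank_evenPencil_one_inf_ker_fst_le base b₀ hμ
  set C := base.evenPencil (fun _ => 1) ⊓
    LinearMap.ker (LinearMap.fst (ZMod 2) (Fin (k + 1) → ZMod 2) (Fin (k + 1) → ZMod 2)) with hC
  set A := base.evenPencil (fun _ => 1) ⊓
    LinearMap.ker (LinearMap.snd (ZMod 2) (Fin (k + 1) → ZMod 2) (Fin (k + 1) → ZMod 2)) with hA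
  have hCA : C ⊓ A = ⊥ := by
    rw [Submodule.eq_bot_iff]
    intro p hp
    obtain ⟨hpC, hpA⟩ := Submodule.mem_inf.1 hp
    have h1 : p.1 = 0 := by
      have := (Submodule.mem_inf.1 hpC).2
      rwa [LinearMap.mem_ker, LinearMap.fst_apply] at this
    have h2 : p.2 = 0 := by
      have := (Submodule.mem_inf.1 hpA).2
      rwa [LinearMap.mem_ker, LinearMap.snd_apply] at this
    exact Prod.ext h1 h2
  have hsup : C ⊔ A ≤ base.evenPencil (fun _ => 1) := sup_le inf_le_left inf_le_left
  have hW := finrank_evenPencil_eq base (fun _ => 1) (evenPencil_one_legit base b₀ ((hμ b₀).2 rfl))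
  have hsum := Submodule.finrank_sup_add_finrank_inf_eq C A
  rw [hCA, finrank_bot, add_zero] at hsum
  have hmono := Submodule.finrank_mono hsup
  omega

/-- ★★★ **μ = 1 EVEN DOOR AT δ = 1 (two conditions).** For an even base `E_{2·P₀⋯P_k}` with exactly one prime `≡ 3 (mod 4)` (index `b₀`),
put `τ₀ := (dim 𝒦_ev + 1)/2`. If the even pencil at `δ = 1` meets `V × 0` and the diagonal in dimension `≤ τ₀`, then a pattern-free Heegner
recipe with `τ₀ + 1` auxiliary primes exists: cells `c₁ :: rest`, `|rest| = τ₀`, with `heegnerK` and Monsky's even matrix invertible for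
EVERY mutual pattern. (EVEN THEOREM A at `δ = 1`; legitimacy by `evenPencil_one_legit`, the `0 × V` condition by
`finrank_evenPencil_one_inf_ker_fst_le`.) Both remaining conditions are genuine: the K = 5 base of `even_universality_fails` (p750799) has μ = 1.
[cite: HeathBrown1994SelmerCongruentII, Appendix (Monsky), typescript p. 41 L20–L36] -/
theorem exists_patternFree_even_design_one_of_muOne (b₀ : Fin (k + 1)) (hμ : ∀ b, negNegOne (base.cls b) = true ↔ b = b₀)
    (h1 : finrank (ZMod 2) ↥(base.evenPencil (fun _ => 1) ⊓
      LinearMap.ker (LinearMap.snd (ZMod 2) (Fin (k + 1) → ZMod 2) (Fin (k + 1) → ZMod 2))) ≤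
        (finrank (ZMod 2) ↥base.evenVirtualKernel + 1) / 2)
    (h3 : finrank (ZMod 2) ↥(base.evenPencil (fun _ => 1) ⊓
      LinearMap.ker (LinearMap.fst (ZMod 2) (Fin (k + 1) → ZMod 2) (Fin (k + 1) → ZMod 2) +
        LinearMap.snd (ZMod 2) (Fin (k + 1) → ZMod 2) (Fin (k + 1) → ZMod 2))) ≤
        (finrank (ZMod 2) ↥base.evenVirtualKernel + 1) / 2) :
    ∃ (c₁ : AuxCell) (rest : List AuxCell), rest.length = (finrank (ZMod 2) ↥base.evenVirtualKernel + 1) / 2 ∧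
      heegnerK base (c₁ :: rest) = true ∧ ∀ pat : ℕ → ℕ → Bool, (dataK base (c₁ :: rest) pat).monskyEvenS.det = 1 := by
  have hm := bz_negNegOne_eq base b₀ hμ
  have hμ1 : (∑ b, bz (negNegOne (base.cls b))) = 1 := by
    rw [Finset.sum_congr rfl fun j (_ : j ∈ Finset.univ) => by rw [hm j]]
    simp
  exact exists_patternFree_even_design_pencil_of_odd base hμ1 (fun _ => 1) (evenPencil_one_legit base b₀ ((hμ b₀).2 rfl)) h1
    ((finrank_evenPencil_one_inf_ker_fst_le base b₀ hμ).trans h1) h3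

end MuOneEven

end Summit.BirchSwinnertonDyer.BirchSwinnertonDyer.Theorems.SymbolicMonsky
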